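import Summits.MatrixMultiplication.MatrixMultiplication.Theses.SnSubsetDichotomy
import Summits.MatrixMultiplication.MatrixMultiplication.Theorems.SnSubsetDichotomyThresholdSubsetTriplesStubCayleyDeletion
import Summits.MatrixMultiplication.MatrixMultiplication.Theorems.SnSubsetDichotomyThresholdSubsetTriplesStubTwistFreeOfBlocked
import Summits.MatrixMultiplication.MatrixMultiplication.Theorems.SnSubsetDichotomyThresholdSubsetTriplesStubTppOfTwistFree
import Summits.MatrixMultiplication.MatrixMultiplication.Theorems.SnSubsetDichotomyThresholdSubsetTriplesStubCubeThreshold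
import Summits.MatrixMultiplication.MatrixMultiplication.Theorems.ThresholdSubsetTriples.Negative.SubgroupMemberFalse
import Summits.MatrixMultiplication.MatrixMultiplication.Theorems.ThresholdSubsetTriples.Negative.PairwiseVoid

/-!
# Strategist sketch 3 — BC2-REDIRECT re-audit of the deciding crux
# `SnSubsetDichotomy.ThresholdSubsetTriples` (stmt-MatrixMultiplication-10882)

Crux-strategist seat `planner-cstrat-stmt-MatrixMultiplication-10882-r1-0` (RESTATED bin, 2026-08-17).
Typed forms of the candidate decompositions `X₁ ∧ … ∧ X_k → X` examined in `STRATEGY-CENSUS.md` v3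
(§Decomposition D1–D7), with every ASSEMBLY proved (criterion (b) is never the obstacle) and the
logical position of each piece relative to `X` made explicit (`X → piece`, `piece → X` via which
landed theorem).  Sorry-free.  Nothing here is a line or a stub; the cheap probes of criterion (c)
live in the separate files `bc/probe_*.lean` (they are REQUIRED to fail, so they cannot live here).

* §0  scales (`Beats`, `ThresholdAt`, antitone).
* §D1 scale split `SubexpSqrtFamily ∧ ScaleHalving ↔ X` (a genuine factorisation into two strictly
      weaker statements; fails only (d)).
* §D2 symmetric bridge `SymmetricThreshold` (= `C⁺`): landed, CHEAP bridge ⇒ a strengthening in costume.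
* §D3 `BlockedHosts`: landed iff with `C⁺` (p140745) ⇒ reformulation of a strengthening.
* §D4 region / clique split `RegionTriples P ∧ CliqueRich P → X` for EVERY interface predicate `P`
      (assembly proved; converse `cornerFree_quot_of_tpp`; the census explains why no `P` has a plan on
      both sides).
* §D5 pairwise ∧ refinement: `PairwiseThreshold` is a landed THEOREM (p117792); the universal refinement
      piece implies `X` through it; its existential form is `X` verbatim.
* §D6 almost-TPP ∧ deletion: bridge PROVED here from the landed Cayley deletion (p85947); `X → Almost`
      with empty blocking sets ⇒ `Almost ↔ X`, a reformulation.
* §D7 one subgroup member: REFUTED for `X` (landed `not_thresholdSubgroupMemberTriples`); alive only for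
      the one-scale milestone `ThresholdAt c`, `c ≥ c₂/2`.
-/

namespace Summit.MatrixMultiplication.MatrixMultiplication.Cruxes.ThresholdSubsetTriples.Strategist3

open scoped BigOperators Classical
open Summit.MatrixMultiplication.MatrixMultiplication.Theses.SnSubsetDichotomy
open Literature.Combinatorics.Additive

set_option linter.dupNamespace false
set_option autoImplicit false

/-! ## §0 Scales -/

/-- The volume condition of the crux at scale `c`. -/
def Beats (c : ℝ) (n : ℕ) (S T U : Finset (Equiv.Perm (Fin n))) : Prop :=
  (n.factorial : ℝ) ^ ((3 : ℝ) / 2) * Real.exp (-(c * Real.sqrt (n : ℝ))) <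
    ((S.card * T.card * U.card : ℕ) : ℝ)

/-- The crux at one fixed scale `c` (cofinally in `n`). -/
def ThresholdAt (c : ℝ) : Prop :=
  ∀ n₀ : ℕ, ∃ n ≥ n₀, ∃ S T U : Finset (Equiv.Perm (Fin n)),
    TripleProductProperty S T U ∧ Beats c n S T U

theorem thresholdSubsetTriples_iff : ThresholdSubsetTriples ↔ ∀ c : ℝ, 0 < c → ThresholdAt c :=
  Iff.rfl

theorem Beats.mono {c c' : ℝ} (h : c ≤ c') {n : ℕ} {S T U : Finset (Equiv.Perm (Fin n))}
    (hB : Beats c n S T U) : Beats c' n S T U := by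
  unfold Beats at hB ⊢
  refine lt_of_le_of_lt ?_ hB
  have hs : 0 ≤ Real.sqrt (n : ℝ) := Real.sqrt_nonneg _
  gcongr

theorem ThresholdAt.anti {c c' : ℝ} (h : c ≤ c') (hc : ThresholdAt c) : ThresholdAt c' := by
  intro n₀
  obtain ⟨n, hn, S, T, U, hT, hB⟩ := hc n₀
  exact ⟨n, hn, S, T, U, hT, hB.mono h⟩

/-- The threshold at scale `c/3` per set cubes to the threshold at scale `c` for the volume. -/
theorem cube_threshold (c : ℝ) (n : ℕ) :
    (Real.sqrt (n.factorial : ℝ) * Real.exp (-(c / 3 * Real.sqrt (n : ℝ)))) ^ 3 =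
      (n.factorial : ℝ) ^ ((3 : ℝ) / 2) * Real.exp (-(c * Real.sqrt (n : ℝ))) := by
  have hF : (0 : ℝ) ≤ (n.factorial : ℝ) := Nat.cast_nonneg _
  rw [mul_pow]
  congr 1
  · rw [Real.sqrt_eq_rpow, ← Real.rpow_natCast, ← Real.rpow_mul hF]
    norm_num
  · rw [← Real.exp_nat_mul]
    congr 1
    push_cast
    ring

/-- Three sets above the per-set threshold at `c/3` beat the volume threshold at `c`. -/
theorem beats_of_card_gt {c : ℝ} {n : ℕ} {S T U : Finset (Equiv.Perm (Fin n))}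
    (hS : Real.sqrt (n.factorial : ℝ) * Real.exp (-(c / 3 * Real.sqrt (n : ℝ))) < (S.card : ℝ))
    (hT : Real.sqrt (n.factorial : ℝ) * Real.exp (-(c / 3 * Real.sqrt (n : ℝ))) < (T.card : ℝ))
    (hU : Real.sqrt (n.factorial : ℝ) * Real.exp (-(c / 3 * Real.sqrt (n : ℝ))) < (U.card : ℝ)) :
    Beats c n S T U := by
  unfold Beats
  set M : ℝ := Real.sqrt (n.factorial : ℝ) * Real.exp (-(c / 3 * Real.sqrt (n : ℝ))) with hM
  have hM0 : 0 ≤ M := by positivity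
  rw [← cube_threshold, ← hM]
  have hcast : ((S.card * T.card * U.card : ℕ) : ℝ) = (S.card : ℝ) * (T.card : ℝ) * (U.card : ℝ) := by
    push_cast; ring
  rw [hcast, pow_succ, pow_two]
  exact mul_lt_mul'' (mul_lt_mul'' hS hT hM0 hM0) hU (mul_nonneg hM0 hM0) hM0

/-! ## §D1 The scale split — a genuine factorisation `X ↔ Sub₁ ∧ Sub₂`, failing only on plans -/

/-- `Sub₁`: SOME `e^{-O(√n)}` family (BCCGU 2017 §5 calibration milestone). Strictly weaker than `X`. -/
def SubexpSqrtFamily : Prop := ∃ c : ℝ, 0 < c ∧ ThresholdAt c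

/-- `Sub₂`: scale halving (amplification). A consequence of `X`; no mechanism inside `S_n`. -/
def ScaleHalving : Prop := ∀ c : ℝ, 0 < c → ThresholdAt c → ThresholdAt (c / 2)

theorem subexpSqrtFamily_of_thresholdSubsetTriples (h : ThresholdSubsetTriples) : SubexpSqrtFamily :=
  ⟨1, one_pos, h 1 one_pos⟩

theorem scaleHalving_of_thresholdSubsetTriples (h : ThresholdSubsetTriples) : ScaleHalving :=
  fun c hc _ => h (c / 2) (by positivity)

/-- Assembly of D1 (criterion (b)): `Sub₁ → Sub₂ → X`. -/
theorem thresholdSubsetTriples_of_subs (h₁ : SubexpSqrtFamily) (h₂ : ScaleHalving) :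
    ThresholdSubsetTriples := by
  obtain ⟨c₀, hc₀, h₀⟩ := h₁
  have hk : ∀ k : ℕ, ThresholdAt (c₀ / 2 ^ k) := by
    intro k
    induction k with
    | zero => simpa using h₀
    | succ k ih =>
      have h := h₂ (c₀ / 2 ^ k) (by positivity) ih
      rw [pow_succ, ← div_div]
      exact h
  intro c hc n₀
  obtain ⟨k, hk'⟩ := exists_pow_lt_of_lt_one (div_pos hc hc₀) (by norm_num : (1 / 2 : ℝ) < 1)
  have hle : c₀ / 2 ^ k ≤ c := by
    have h1 : c₀ * (1 / 2) ^ k < c₀ * (c / c₀) := mul_lt_mul_of_pos_left hk' hc₀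
    have h2 : c₀ * (c / c₀) = c := by field_simp
    have h3 : c₀ * (1 / 2) ^ k = c₀ / 2 ^ k := by rw [one_div_pow, mul_one_div]
    rw [h2, h3] at h1
    exact h1.le
  exact (ThresholdAt.anti hle (hk k)) n₀

/-- D1 is a FACTORISATION: `X ↔ Sub₁ ∧ Sub₂` (both pieces are consequences of `X`, jointly equivalent). -/
theorem thresholdSubsetTriples_iff_subs : ThresholdSubsetTriples ↔ SubexpSqrtFamily ∧ ScaleHalving :=
  ⟨fun h => ⟨subexpSqrtFamily_of_thresholdSubsetTriples h, scaleHalving_of_thresholdSubsetTriples h⟩,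
    fun h => thresholdSubsetTriples_of_subs h.1 h.2⟩

/-! ## §D2 The symmetric bridge `C⁺` — landed and CHEAP (forget the symmetry) -/

/-- `C⁺` (symmetric threshold; Census c6 §1 verbatim; hypothesis of the landed
`thresholdSubsetTriples_of_symmetricThreshold`, p140745). -/
def SymmetricThreshold : Prop :=
  ∀ c : ℝ, 0 < c → ∀ n₀ : ℕ, ∃ n ≥ n₀, ∃ τ : Equiv.Perm (Fin n), τ ^ 3 = 1 ∧
    ∃ X : Finset (Equiv.Perm (Fin n)),
      (∀ x₁ ∈ X, ∀ x₁' ∈ X, ∀ x₂ ∈ X, ∀ x₂' ∈ X, ∀ x₃ ∈ X, ∀ x₃' ∈ X,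
        x₁ * x₁'⁻¹ * τ * (x₂ * x₂'⁻¹) * τ * (x₃ * x₃'⁻¹) * τ = 1 → x₁ = x₁' ∧ x₂ = x₂' ∧ x₃ = x₃') ∧
      Real.sqrt (n.factorial : ℝ) * Real.exp (-(c * Real.sqrt (n : ℝ))) < (X.card : ℝ)

/-- The bridge of D2 is a tree theorem (`thresholdSubsetTriples_of_symmetricThreshold`, p140745 — its module was
unbuilt on the farm during this session, so its ten-line proof is reproduced verbatim from the landed file: take
`(X, τXτ⁻¹, τ²Xτ⁻²)`, `stub_tpp_of_twistFree` p85977 + `stub_cubeThreshold` p86006). -/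
theorem thresholdSubsetTriples_of_symmetricThreshold' (h : SymmetricThreshold) :
    ThresholdSubsetTriples := by
  intro c hc n₀
  obtain ⟨n, hn, τ, hτ, X, htw, hbig⟩ := h (c / 3) (by positivity) n₀
  have hinj : ∀ g : Equiv.Perm (Fin n), Function.Injective (fun x : Equiv.Perm (Fin n) => g * x * g⁻¹) := by
    intro g a b hab
    simpa using hab
  refine ⟨n, hn, X, X.image (fun x => τ * x * τ⁻¹), X.image (fun x => τ ^ 2 * x * (τ ^ 2)⁻¹),
    Summit.MatrixMultiplication.MatrixMultiplication.Theorems.ThresholdSubsetTriples.stub_tpp_of_twistFree n τ X hτ htw, ?_⟩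
  rw [Finset.card_image_of_injective _ (hinj _), Finset.card_image_of_injective _ (hinj _)]
  exact Summit.MatrixMultiplication.MatrixMultiplication.Theorems.ThresholdSubsetTriples.stub_cubeThreshold c n X.card hbig

/-! ## §D3 Blocked hosts — landed iff with `C⁺` -/

/-- `BlockedHosts` (= the one open stub of the dead line `SketchIdeator2`). -/
def BlockedHosts : Prop :=
  ∀ c : ℝ, 0 < c → ∀ n₀ : ℕ, ∃ n ≥ n₀, ∃ τ : Equiv.Perm (Fin n), τ ^ 3 = 1 ∧
    ∃ K B : Finset (Equiv.Perm (Fin n)),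
      (∀ x₁ ∈ K, ∀ x₁' ∈ K, ∀ x₂ ∈ K, ∀ x₂' ∈ K, ∀ x₃ ∈ K, ∀ x₃' ∈ K,
        x₁ * x₁'⁻¹ * τ * (x₂ * x₂'⁻¹) * τ * (x₃ * x₃'⁻¹) * τ = 1 →
          (x₁ = x₁' ∧ x₂ = x₂' ∧ x₃ = x₃') ∨ (x₁ * x₁'⁻¹ ∈ B ∧ x₁ ≠ x₁') ∨
            (x₂ * x₂'⁻¹ ∈ B ∧ x₂ ≠ x₂') ∨ (x₃ * x₃'⁻¹ ∈ B ∧ x₃ ≠ x₃')) ∧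
      ((2 * B.card + 1 : ℕ) : ℝ) * (Real.sqrt (n.factorial : ℝ) * Real.exp (-(c * Real.sqrt (n : ℝ)))) <
        (K.card : ℝ)

/-- Landed iff (p140745, `symmetricThreshold_iff_blockedHosts`; proof reproduced verbatim, module unbuilt on the farm this
session): `BlockedHosts ↔ C⁺` at the same scale — the blocking set is cosmetic (`B := ∅` one way; Cayley deletion
p85947 + `stub_twistFree_of_blocked` p85948 the other, the factor `2|B|+1` cancelling exactly). -/
theorem blockedHosts_iff_symmetricThreshold : BlockedHosts ↔ SymmetricThreshold := by
  constructor
  · intro h c hc n₀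
    obtain ⟨n, hn, τ, hτ, K, B, hBl, hbig⟩ := h c hc n₀
    obtain ⟨X, hXK, hA, hcard⟩ :=
      Summit.MatrixMultiplication.MatrixMultiplication.Theorems.ThresholdSubsetTriples.stub_cayleyDeletion n K B
    refine ⟨n, hn, τ, hτ, X,
      Summit.MatrixMultiplication.MatrixMultiplication.Theorems.ThresholdSubsetTriples.stub_twistFree_of_blocked
        n τ K B X hXK hBl hA, ?_⟩
    have hpos : (0 : ℝ) < ((2 * B.card + 1 : ℕ) : ℝ) := by positivity
    have hKX : (K.card : ℝ) ≤ ((2 * B.card + 1 : ℕ) : ℝ) * (X.card : ℝ) := by exact_mod_cast hcard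
    exact lt_of_mul_lt_mul_left (lt_of_lt_of_le hbig hKX) hpos.le
  · intro h c hc n₀
    obtain ⟨n, hn, τ, hτ, X, htw, hbig⟩ := h c hc n₀
    refine ⟨n, hn, τ, hτ, X, ∅, ?_, ?_⟩
    · intro x₁ h₁ x₁' h₁' x₂ h₂ x₂' h₂' x₃ h₃ x₃' h₃' heq
      exact Or.inl (htw x₁ h₁ x₁' h₁' x₂ h₂ x₂' h₂' x₃ h₃ x₃' h₃' heq)
    · simpa using hbig

theorem thresholdSubsetTriples_of_blockedHosts (h : BlockedHosts) : ThresholdSubsetTriples :=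
  thresholdSubsetTriples_of_symmetricThreshold' (blockedHosts_iff_symmetricThreshold.1 h)

/-! ## §D4 Region / clique split — assembly proved for every interface predicate `P` -/

section Regions

variable {G : Type*} [Group G] [DecidableEq G]

/-- A corner-free triple of quotient REGIONS: no solution of `r₁ r₂ r₃ = 1` with
`rᵢ ∈ Rᵢ ∪ {1}` other than `(1,1,1)`. -/
def CornerFree (R₁ R₂ R₃ : Finset G) : Prop :=
  ∀ r₁ ∈ insert (1 : G) R₁, ∀ r₂ ∈ insert (1 : G) R₂, ∀ r₃ ∈ insert (1 : G) R₃,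
    r₁ * r₂ * r₃ = 1 → r₁ = 1 ∧ r₂ = 1 ∧ r₃ = 1

/-- `S` is an `R`-clique of the Cayley graph `Cay(G, R)`: all non-trivial quotients `s s'⁻¹` lie in `R`. -/
def IsQuotClique (R S : Finset G) : Prop := ∀ s ∈ S, ∀ s' ∈ S, s ≠ s' → s * s'⁻¹ ∈ R

theorem quot_mem_insert {R S : Finset G} (hS : IsQuotClique R S) {s s' : G} (hs : s ∈ S)
    (hs' : s' ∈ S) : s * s'⁻¹ ∈ insert (1 : G) R := by
  by_cases h : s = s'
  · subst h; simp
  · exact Finset.mem_insert_of_mem (hS s hs s' hs' h)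

/-- **The interface lemma.** Cliques of a corner-free region triple form a TPP triple — the three sets
interact ONLY through the regions. -/
theorem tpp_of_cliques {R₁ R₂ R₃ S T U : Finset G} (hR : CornerFree R₁ R₂ R₃)
    (hS : IsQuotClique R₁ S) (hT : IsQuotClique R₂ T) (hU : IsQuotClique R₃ U) :
    TripleProductProperty S T U := by
  intro s hs s' hs' t ht t' ht' u hu u' hu' e
  obtain ⟨e1, e2, e3⟩ := hR _ (quot_mem_insert hS hs hs') _ (quot_mem_insert hT ht ht') _
    (quot_mem_insert hU hu hu') e
  exact ⟨mul_inv_eq_one.1 e1, mul_inv_eq_one.1 e2, mul_inv_eq_one.1 e3⟩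

/-- The punctured quotient set `Q(S)∖{1}`. -/
def quotRegion (S : Finset G) : Finset G := (Finset.image₂ (fun s s' => s * s'⁻¹) S S).erase 1

/-- Every set is a clique of its own punctured quotient set. -/
theorem isQuotClique_quotRegion (S : Finset G) : IsQuotClique (quotRegion S) S := by
  intro s hs s' hs' hne
  refine Finset.mem_erase.2 ⟨?_, Finset.mem_image₂_of_mem hs hs'⟩
  intro h
  exact hne (mul_inv_eq_one.1 h)

theorem exists_rep_of_mem_quotRegion {S : Finset G} (hS : S.Nonempty) {r : G}
    (hr : r ∈ insert (1 : G) (quotRegion S)) : ∃ s ∈ S, ∃ s' ∈ S, s * s'⁻¹ = r := by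
  rw [Finset.mem_insert] at hr
  rcases hr with rfl | hr
  · obtain ⟨s₀, hs₀⟩ := hS
    exact ⟨s₀, hs₀, s₀, hs₀, by simp⟩
  · obtain ⟨-, hr⟩ := Finset.mem_erase.1 hr
    simpa [Finset.mem_image₂] using hr

/-- Conversely every TPP triple of non-empty sets is a clique triple of the corner-free regions
`Q(S)∖1, Q(T)∖1, Q(U)∖1` — so with `P := "is the punctured quotient set of a large set"` piece B of
D4 is trivial and piece A is `X` again (census D4). -/
theorem cornerFree_quotRegion_of_tpp {S T U : Finset G} (h : TripleProductProperty S T U)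
    (hS : S.Nonempty) (hT : T.Nonempty) (hU : U.Nonempty) :
    CornerFree (quotRegion S) (quotRegion T) (quotRegion U) := by
  intro r₁ hr₁ r₂ hr₂ r₃ hr₃ e
  obtain ⟨s, hs, s', hs', rfl⟩ := exists_rep_of_mem_quotRegion hS hr₁
  obtain ⟨t, ht, t', ht', rfl⟩ := exists_rep_of_mem_quotRegion hT hr₂
  obtain ⟨u, hu, u', hu', rfl⟩ := exists_rep_of_mem_quotRegion hU hr₃
  obtain ⟨h1, h2, h3⟩ := h s hs s' hs' t ht t' ht' u hu u' hu' e
  subst h1; subst h2; subst h3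
  simp

end Regions

/-- Piece A of D4: corner-free region triples with interface property `P` exist cofinally. -/
def RegionTriples (P : (n : ℕ) → Finset (Equiv.Perm (Fin n)) → Prop) : Prop :=
  ∀ n₀ : ℕ, ∃ n ≥ n₀, ∃ R₁ R₂ R₃ : Finset (Equiv.Perm (Fin n)),
    CornerFree R₁ R₂ R₃ ∧ P n R₁ ∧ P n R₂ ∧ P n R₃

/-- Piece B of D4: every `P`-region has cliques within `e^{-o(√n)}` of `√(n!)`. -/
def CliqueRich (P : (n : ℕ) → Finset (Equiv.Perm (Fin n)) → Prop) : Prop :=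
  ∀ c : ℝ, 0 < c → ∃ n₀ : ℕ, ∀ n ≥ n₀, ∀ R : Finset (Equiv.Perm (Fin n)), P n R →
    ∃ S : Finset (Equiv.Perm (Fin n)), IsQuotClique R S ∧
      Real.sqrt (n.factorial : ℝ) * Real.exp (-(c * Real.sqrt (n : ℝ))) < (S.card : ℝ)

/-- Assembly of D4 (criterion (b)), for EVERY interface predicate. -/
theorem thresholdSubsetTriples_of_regions (P : (n : ℕ) → Finset (Equiv.Perm (Fin n)) → Prop)
    (hA : RegionTriples P) (hB : CliqueRich P) : ThresholdSubsetTriples := by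
  intro c hc n₀
  obtain ⟨n₁, hn₁⟩ := hB (c / 3) (by positivity)
  obtain ⟨n, hn, R₁, R₂, R₃, hR, h1, h2, h3⟩ := hA (max n₀ n₁)
  have hn1 : n₁ ≤ n := le_trans (le_max_right _ _) hn
  obtain ⟨S, hS, hSc⟩ := hn₁ n hn1 R₁ h1
  obtain ⟨T, hT, hTc⟩ := hn₁ n hn1 R₂ h2
  obtain ⟨U, hU, hUc⟩ := hn₁ n hn1 R₃ h3
  exact ⟨n, le_trans (le_max_left _ _) hn, S, T, U, tpp_of_cliques hR hS hT hU,
    beats_of_card_gt hSc hTc hUc⟩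

/-! ## §D5 Pairwise ∧ refinement — the bridge piece is a landed THEOREM -/

/-- The three two-set consequences of the TPP. -/
def PairwiseTPP {n : ℕ} (S T U : Finset (Equiv.Perm (Fin n))) : Prop :=
  (∀ s ∈ S, ∀ s' ∈ S, ∀ t ∈ T, ∀ t' ∈ T, s * s'⁻¹ * (t * t'⁻¹) = 1 → s = s' ∧ t = t') ∧
  (∀ t ∈ T, ∀ t' ∈ T, ∀ u ∈ U, ∀ u' ∈ U, t * t'⁻¹ * (u * u'⁻¹) = 1 → t = t' ∧ u = u') ∧
  (∀ s ∈ S, ∀ s' ∈ S, ∀ u ∈ U, ∀ u' ∈ U, s * s'⁻¹ * (u * u'⁻¹) = 1 → s = s' ∧ u = u')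

/-- Piece T of D5: pairwise-TPP triples at threshold exist. -/
def PairwiseThreshold : Prop :=
  ∀ c : ℝ, 0 < c → ∀ n₀ : ℕ, ∃ n ≥ n₀, ∃ S T U : Finset (Equiv.Perm (Fin n)),
    PairwiseTPP S T U ∧ Beats c n S T U

/-- T is PROVED in the tree (rooted stabilisers, `Negative/PairwiseVoid.lean`, p117792). -/
theorem pairwiseThreshold_holds : PairwiseThreshold :=
  Summit.MatrixMultiplication.MatrixMultiplication.Theorems.ThresholdSubsetTriples.Negative.thresholdSubsetTriplesPairwise_holds

/-- Piece U of D5 (universal refinement): every pairwise-TPP triple at some finer scale `c'` contains a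
TPP sub-triple at scale `c`. -/
def PairwiseRefinement : Prop :=
  ∀ c : ℝ, 0 < c → ∃ c' : ℝ, 0 < c' ∧ ∃ n₀ : ℕ, ∀ n ≥ n₀, ∀ S T U : Finset (Equiv.Perm (Fin n)),
    PairwiseTPP S T U → Beats c' n S T U →
      ∃ S' ⊆ S, ∃ T' ⊆ T, ∃ U' ⊆ U, TripleProductProperty S' T' U' ∧ Beats c n S' T' U'

/-- Assembly of D5 (criterion (b)). -/
theorem thresholdSubsetTriples_of_pairwise (hA : PairwiseThreshold) (hB : PairwiseRefinement) :
    ThresholdSubsetTriples := by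
  intro c hc n₀
  obtain ⟨c', hc', n₁, hn₁⟩ := hB c hc
  obtain ⟨n, hn, S, T, U, hP, hBt⟩ := hA c' hc' (max n₀ n₁)
  obtain ⟨S', -, T', -, U', -, hT', hB'⟩ := hn₁ n (le_trans (le_max_right _ _) hn) S T U hP hBt
  exact ⟨n, le_trans (le_max_left _ _) hn, S', T', U', hT', hB'⟩

/-- Since T is a theorem, U ALONE gives `X` (modulo the tree): the open piece of a `proved ∧ open` split
is always at least `X`. -/
theorem thresholdSubsetTriples_of_pairwiseRefinement (hB : PairwiseRefinement) : ThresholdSubsetTriples :=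
  thresholdSubsetTriples_of_pairwise pairwiseThreshold_holds hB

/-- The EXISTENTIAL refinement piece ("some pairwise triple refines") is `X` verbatim up to `⊆`. -/
def PairwiseRefinementExists : Prop :=
  ∀ c : ℝ, 0 < c → ∀ n₀ : ℕ, ∃ n ≥ n₀, ∃ S T U : Finset (Equiv.Perm (Fin n)), PairwiseTPP S T U ∧
    ∃ S' ⊆ S, ∃ T' ⊆ T, ∃ U' ⊆ U, TripleProductProperty S' T' U' ∧ Beats c n S' T' U'

theorem pairwiseRefinementExists_iff : PairwiseRefinementExists ↔ ThresholdSubsetTriples := by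
  constructor
  · intro h c hc n₀
    obtain ⟨n, hn, S, T, U, -, S', -, T', -, U', -, hT', hB'⟩ := h c hc n₀
    exact ⟨n, hn, S', T', U', hT', hB'⟩
  · intro h c hc n₀
    obtain ⟨n, hn, S, T, U, hT, hB⟩ := h c hc n₀
    by_cases hne : S.Nonempty ∧ T.Nonempty ∧ U.Nonempty
    · refine ⟨n, hn, S, T, U, ?_, S, subset_rfl, T, subset_rfl, U, subset_rfl, hT, hB⟩
      exact Summit.MatrixMultiplication.MatrixMultiplication.Theorems.ThresholdSubsetTriples.Negative.pairwiseTPP_of_tripleProductProperty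
        hT hne.1 hne.2.1 hne.2.2
    · -- an empty set has volume 0, contradicting `Beats`
      exfalso
      have h0 : S.card * T.card * U.card = 0 := by
        simp only [not_and_or, Finset.not_nonempty_iff_eq_empty] at hne
        rcases hne with h | h | h <;> simp [h]
      rw [h0] at hB
      have : (0 : ℝ) < (n.factorial : ℝ) ^ ((3 : ℝ) / 2) * Real.exp (-(c * Real.sqrt (n : ℝ))) := by
        positivity
      simp at hB
      linarith

/-! ## §D6 Almost-TPP ∧ deletion — bridge proved from the landed Cayley deletion; `Almost ↔ X` -/

section Blocked

variable {G : Type*} [Group G]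

/-- Blocking sets `B₁, B₂, B₃` catch every non-trivial solution of the TPP equation. -/
def Blocked (S T U B₁ B₂ B₃ : Finset G) : Prop :=
  ∀ s ∈ S, ∀ s' ∈ S, ∀ t ∈ T, ∀ t' ∈ T, ∀ u ∈ U, ∀ u' ∈ U,
    s * s'⁻¹ * (t * t'⁻¹) * (u * u'⁻¹) = 1 →
      (s = s' ∧ t = t' ∧ u = u') ∨ (s * s'⁻¹ ∈ B₁ ∧ s ≠ s') ∨ (t * t'⁻¹ ∈ B₂ ∧ t ≠ t') ∨
        (u * u'⁻¹ ∈ B₃ ∧ u ≠ u')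

/-- `X` avoids `B`: no two distinct elements of `X` have quotient in `B`. -/
def Avoids (B X : Finset G) : Prop := ∀ x ∈ X, ∀ x' ∈ X, x * x'⁻¹ ∈ B → x = x'

theorem blocked_of_tpp (S T U : Finset G) (h : TripleProductProperty S T U) :
    Blocked S T U ∅ ∅ ∅ :=
  fun s hs s' hs' t ht t' ht' u hu u' hu' e => Or.inl (h s hs s' hs' t ht t' ht' u hu u' hu' e)

/-- Deletion repairs a blocked triple: sub-sets avoiding the blocking sets form a TPP triple. -/
theorem tpp_of_blocked_of_avoids {S T U B₁ B₂ B₃ S' T' U' : Finset G} (h : Blocked S T U B₁ B₂ B₃)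
    (hS : S' ⊆ S) (hT : T' ⊆ T) (hU : U' ⊆ U) (h₁ : Avoids B₁ S') (h₂ : Avoids B₂ T')
    (h₃ : Avoids B₃ U') : TripleProductProperty S' T' U' := by
  intro s hs s' hs' t ht t' ht' u hu u' hu' e
  rcases h s (hS hs) s' (hS hs') t (hT ht) t' (hT ht') u (hU hu) u' (hU hu') e with
    h0 | ⟨hb, hne⟩ | ⟨hb, hne⟩ | ⟨hb, hne⟩
  · exact h0
  · exact absurd (h₁ s hs s' hs' hb) hne
  · exact absurd (h₂ t ht t' ht' hb) hne
  · exact absurd (h₃ u hu u' hu' hb) hne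

end Blocked

/-- Piece T of D6: almost-TPP triples (blocked by SMALL sets) above `∏(2|Bᵢ|+1)` times the threshold. -/
def AlmostThreshold : Prop :=
  ∀ c : ℝ, 0 < c → ∀ n₀ : ℕ, ∃ n ≥ n₀, ∃ S T U B₁ B₂ B₃ : Finset (Equiv.Perm (Fin n)),
    Blocked S T U B₁ B₂ B₃ ∧
      ((2 * B₁.card + 1 : ℕ) : ℝ) * ((2 * B₂.card + 1 : ℕ) : ℝ) * ((2 * B₃.card + 1 : ℕ) : ℝ) *
          ((n.factorial : ℝ) ^ ((3 : ℝ) / 2) * Real.exp (-(c * Real.sqrt (n : ℝ)))) <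
        ((S.card * T.card * U.card : ℕ) : ℝ)

/-- `X → Almost` with empty blocking sets (trivial direction). -/
theorem almostThreshold_of_thresholdSubsetTriples (h : ThresholdSubsetTriples) : AlmostThreshold := by
  intro c hc n₀
  obtain ⟨n, hn, S, T, U, hT, hB⟩ := h c hc n₀
  refine ⟨n, hn, S, T, U, ∅, ∅, ∅, blocked_of_tpp S T U hT, ?_⟩
  simpa using hB

/-- `Almost → X` — the NON-trivial direction, from the landed Cayley deletion
(`stub_cayleyDeletion`, p85947) applied to each set. -/
theorem thresholdSubsetTriples_of_almostThreshold (h : AlmostThreshold) : ThresholdSubsetTriples := by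
  intro c hc n₀
  obtain ⟨n, hn, S, T, U, B₁, B₂, B₃, hBl, hbig⟩ := h c hc n₀
  obtain ⟨S', hS', hS'av, hS'c⟩ :=
    Summit.MatrixMultiplication.MatrixMultiplication.Theorems.ThresholdSubsetTriples.stub_cayleyDeletion n S B₁
  obtain ⟨T', hT', hT'av, hT'c⟩ :=
    Summit.MatrixMultiplication.MatrixMultiplication.Theorems.ThresholdSubsetTriples.stub_cayleyDeletion n T B₂
  obtain ⟨U', hU', hU'av, hU'c⟩ :=
    Summit.MatrixMultiplication.MatrixMultiplication.Theorems.ThresholdSubsetTriples.stub_cayleyDeletion n U B₃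
  refine ⟨n, hn, S', T', U', tpp_of_blocked_of_avoids hBl hS' hT' hU' hS'av hT'av hU'av, ?_⟩
  set P : ℝ := ((2 * B₁.card + 1 : ℕ) : ℝ) * ((2 * B₂.card + 1 : ℕ) : ℝ) * ((2 * B₃.card + 1 : ℕ) : ℝ)
    with hP
  set M : ℝ := (n.factorial : ℝ) ^ ((3 : ℝ) / 2) * Real.exp (-(c * Real.sqrt (n : ℝ))) with hM
  have hP0 : 0 < P := by positivity
  have hnat : S.card * T.card * U.card ≤
      ((2 * B₁.card + 1) * S'.card) * ((2 * B₂.card + 1) * T'.card) * ((2 * B₃.card + 1) * U'.card) :=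
    Nat.mul_le_mul (Nat.mul_le_mul hS'c hT'c) hU'c
  have hreal : ((S.card * T.card * U.card : ℕ) : ℝ) ≤ P * ((S'.card * T'.card * U'.card : ℕ) : ℝ) := by
    have := (Nat.cast_le (α := ℝ)).2 hnat
    refine this.trans (le_of_eq ?_)
    rw [hP]; push_cast; ring
  have hlt : P * M < P * ((S'.card * T'.card * U'.card : ℕ) : ℝ) := lt_of_lt_of_le hbig hreal
  exact lt_of_mul_lt_mul_left hlt hP0.le

/-- So `Almost ↔ X`: D6 is a REFORMULATION (census D6). -/
theorem almostThreshold_iff : AlmostThreshold ↔ ThresholdSubsetTriples :=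
  ⟨thresholdSubsetTriples_of_almostThreshold, almostThreshold_of_thresholdSubsetTriples⟩

/-! ## §D7 One subgroup member — refuted for `X`, alive for the milestone only -/

/-- `X` restricted to triples whose first set is a whole subgroup (signature of the landed negation). -/
def OneSubgroupMemberThreshold : Prop :=
  ∀ c : ℝ, 0 < c → ∀ n₀ : ℕ, ∃ n ≥ n₀, ∃ H : Subgroup (Equiv.Perm (Fin n)),
    ∃ S T U : Finset (Equiv.Perm (Fin n)), (∀ x, x ∈ S ↔ x ∈ H) ∧ TripleProductProperty S T U ∧
      (n.factorial : ℝ) ^ ((3 : ℝ) / 2) * Real.exp (-(c * Real.sqrt (n : ℝ))) <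
        ((S.card * T.card * U.card : ℕ) : ℝ)

/-- REFUTED in the tree (subgroup-pivot sieve + Vershik–Kerov, `not_thresholdSubgroupMemberTriples`). -/
theorem not_oneSubgroupMemberThreshold : ¬ OneSubgroupMemberThreshold :=
  Summit.MatrixMultiplication.MatrixMultiplication.Theorems.ThresholdSubsetTriples.Negative.not_thresholdSubgroupMemberTriples

/-- The one-scale version, alive for `c ≥ c₂/2` (the sieve's range), feeding only the milestone
`ThresholdAt c` / `SubexpSqrtFamily`, never `X`. -/
def OneSubgroupMemberAt (c : ℝ) : Prop :=
  ∀ n₀ : ℕ, ∃ n ≥ n₀, ∃ H : Subgroup (Equiv.Perm (Fin n)),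
    ∃ S T U : Finset (Equiv.Perm (Fin n)), (∀ x, x ∈ S ↔ x ∈ H) ∧ TripleProductProperty S T U ∧
      Beats c n S T U

theorem thresholdAt_of_oneSubgroupMemberAt {c : ℝ} (h : OneSubgroupMemberAt c) : ThresholdAt c := by
  intro n₀
  obtain ⟨n, hn, -, S, T, U, -, hT, hB⟩ := h n₀
  exact ⟨n, hn, S, T, U, hT, hB⟩

theorem subexpSqrtFamily_of_oneSubgroupMemberAt {c : ℝ} (hc : 0 < c) (h : OneSubgroupMemberAt c) :
    SubexpSqrtFamily :=
  ⟨c, hc, thresholdAt_of_oneSubgroupMemberAt h⟩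

theorem oneSubgroupMemberThreshold_iff :
    OneSubgroupMemberThreshold ↔ ∀ c : ℝ, 0 < c → OneSubgroupMemberAt c :=
  Iff.rfl

end Summit.MatrixMultiplication.MatrixMultiplication.Cruxes.ThresholdSubsetTriples.Strategist3
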